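import Mathlib.GroupTheory.Perm.Fin
import Summits.ValiantsHypothesis.ValiantsHypothesis.Theorems.KPlusLogSqLawTropicalBStaticPorts

/-!
# Route `KPlusLogSqLaw`, crux `TropicalB` — size padding for STATIC designs; the port embedding at every size

HONEST FRAMING.  Support file toward the registered stubs `stub_tropThin` / `stub_tropFat` of the crux `TropicalB`
(ledger item `stmt-ValiantsHypothesis-19771`, route `KPlusLogSqLaw`; cell `pub-symmetroid`, seat val-sym-trop-p4, 2026-08-26).
Bookkeeping only; nothing is asserted about `TropicalB` inside its window, `Lifting`, `KPlusLogSqLaw`, `MatrixDescartes` or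
`VP ≠ VNP`.

* `tropRootLawAtStatic_of_succ` — `TropRootLawAtStatic (m+1) K B → TropRootLawAtStatic m K B`: the border construction of
  `KPlusLogSqLaw.tropRootLawAt_of_succ` (`…TropicalBPadding`, val-sym-trop-p1: one new index `0` with the single present
  entry `(0,0)` of one class, sign `+1`, valuation `0`; terms lift by `decomposeFin.symm (0, σ)` / `Fin.cons`) PRESERVES
  STATICNESS, so the same proof gives the static row's monotonicity in the size.  (Proof adapted verbatim from that file,
  with the `IsStatic` hypothesis threaded through.)
* `tropRootLawAtStatic_of_le_size` — `m ≤ m' → TropRootLawAtStatic m' K B → TropRootLawAtStatic m K B`.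
* `tropRootLawAt_of_static_ports_le` — the port embedding at every size: `m·K ≤ M → TropRootLawAtStatic M K B →
  TropRootLawAt m K B`, i.e. `S_static(M, K) ≥ T(⌊M/K⌋, K)` for the capacities.

[folklore]
-/

-- `Summit.ValiantsHypothesis.ValiantsHypothesis.…` repeats a component by the D-0017 layout
-- (single-conjunct summit), which the `dupNamespace` linter flags; the name is mandated.
set_option linter.dupNamespace false
set_option autoImplicit false

namespace Summit.ValiantsHypothesis.ValiantsHypothesis.Theorems.LacunarySymmetroidMatrixDescartes.TropicalCensus

open Summit.ValiantsHypothesis.ValiantsHypothesis.Theorems.MatrixDescartes.Negative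
open Finset

/-- monotonicity of the static row in the bound. [folklore] -/
theorem tropRootLawAtStatic_mono {m K B B' : ℕ} (hBB' : B ≤ B') (h : TropRootLawAtStatic m K B) :
    TropRootLawAtStatic m K B' :=
  fun d v ε n θ p hε hst hθ hdom halt => (h d v ε n θ p hε hst hθ hdom halt).trans hBB'

/-- the static row with no class (`K = 0`) holds for every bound. [folklore] -/
theorem tropRootLawAtStatic_zero (m B : ℕ) : TropRootLawAtStatic m 0 B :=
  tropRootLawAtStatic_of_tropRootLawAt (tropRootLawAt_zero m B)

/-- **Size padding by one, static version.**  `TropRootLawAtStatic (m+1) K B → TropRootLawAtStatic m K B`: border a static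
design of size `m` by a new index `0` whose only present entry is `(0, 0)`, of one class `l₀`, sign `+1`, valuation `0` — a
static design again; lift terms by `(decomposeFin.symm (0, σ), Fin.cons l₀ λ)` (same sign, weight shifted by `θ·d l₀`); every
present term of the bordered design is such a lift.  Adapted from `KPlusLogSqLaw.tropRootLawAt_of_succ`. [folklore] -/
theorem tropRootLawAtStatic_of_succ {m K B : ℕ} (h : TropRootLawAtStatic (m + 1) K B) : TropRootLawAtStatic m K B := by
  intro d v ε n θ p hε hst hθ hdom halt
  rcases Nat.eq_zero_or_pos K with hK0 | hKpos
  · subst hK0; exact tropRootLawAtStatic_zero m B d v ε n θ p hε hst hθ hdom halt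
  set l₀ : Fin K := ⟨0, hKpos⟩ with hl₀
  -- the bordered design
  obtain ⟨εb, hεb⟩ : ∃ εb : Fin (m + 1) → Fin (m + 1) → Fin K → ℤ, ∀ a b l, εb a b l =
      if ha : a = 0 then (if b = 0 then (if l = l₀ then 1 else 0) else 0)
      else (if hb : b = 0 then 0 else ε (a.pred ha) (b.pred hb) l) := ⟨_, fun _ _ _ => rfl⟩
  obtain ⟨vb, hvb⟩ : ∃ vb : Fin (m + 1) → Fin (m + 1) → Fin K → ℤ, ∀ a b l, vb a b l =
      if ha : a = 0 then 0 else (if hb : b = 0 then 0 else v (a.pred ha) (b.pred hb) l) := ⟨_, fun _ _ _ => rfl⟩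
  have hεsucc : ∀ x y l, εb x.succ y.succ l = ε x y l := by
    intro x y l
    rw [hεb, dif_neg (Fin.succ_ne_zero x), dif_neg (Fin.succ_ne_zero y)]
    simp only [Fin.pred_succ]
  have hvsucc : ∀ x y l, vb x.succ y.succ l = v x y l := by
    intro x y l
    rw [hvb, dif_neg (Fin.succ_ne_zero x), dif_neg (Fin.succ_ne_zero y)]
    simp only [Fin.pred_succ]
  have hε00 : εb 0 0 l₀ = 1 := by rw [hεb]; simp
  have hv0 : ∀ b l, vb 0 b l = 0 := by intro b l; rw [hvb]; simp
  have hεb1 : ∀ a b l, (εb a b l).natAbs ≤ 1 := by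
    intro a b l
    rw [hεb]
    split_ifs <;> first | exact hε _ _ _ | simp
  -- the bordered design is static
  have hstb : IsStatic εb := by
    intro a b l l' h1 h2
    rw [hεb] at h1 h2
    by_cases ha : a = 0
    · rw [dif_pos ha] at h1 h2
      by_cases hb : b = 0
      · rw [if_pos hb] at h1 h2
        have e1 : l = l₀ := by by_contra hh; exact h1 (if_neg hh)
        have e2 : l' = l₀ := by by_contra hh; exact h2 (if_neg hh)
        rw [e1, e2]
      · rw [if_neg hb] at h1; exact absurd rfl h1
    · rw [dif_neg ha] at h1 h2
      by_cases hb : b = 0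
      · rw [dif_pos hb] at h1; exact absurd rfl h1
      · rw [dif_neg hb] at h1 h2
        exact hst _ _ _ _ h1 h2
  -- the extension of a permutation: `decomposeFin.symm (0, σ)` fixes `0` and acts by `σ` on successors
  have hext0 : ∀ σ : Equiv.Perm (Fin m), Equiv.Perm.decomposeFin.symm (0, σ) 0 = 0 :=
    fun σ => Equiv.Perm.decomposeFin_symm_apply_zero 0 σ
  have hextsucc : ∀ (σ : Equiv.Perm (Fin m)) (i : Fin m),
      Equiv.Perm.decomposeFin.symm (0, σ) i.succ = (σ i).succ := by
    intro σ i
    rw [Equiv.Perm.decomposeFin_symm_apply_succ, Equiv.swap_self, Equiv.refl_apply]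
  -- sign and weight of a lifted term
  have hsignL : ∀ (σ : Equiv.Perm (Fin m)) (μ : Fin m → Fin K),
      termSign εb (Equiv.Perm.decomposeFin.symm (0, σ), (Fin.cons l₀ μ : Fin (m + 1) → Fin K)) =
        termSign ε (σ, μ) := by
    intro σ μ
    unfold termSign
    simp only
    rw [Equiv.Perm.decomposeFin.symm_sign, if_pos rfl, one_mul, Fin.prod_univ_succ, hext0, Fin.cons_zero, hε00,
      one_mul]
    congr 1
    exact prod_congr rfl fun i _ => by rw [hextsucc, Fin.cons_succ, hεsucc]
  have hweightL : ∀ (σ : Equiv.Perm (Fin m)) (μ : Fin m → Fin K) (t : ℤ),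
      tropWeight d vb t (Equiv.Perm.decomposeFin.symm (0, σ), (Fin.cons l₀ μ : Fin (m + 1) → Fin K)) =
        tropWeight d v t (σ, μ) + t * d l₀ := by
    intro σ μ t
    unfold tropWeight
    simp only
    rw [Fin.sum_univ_succ, Fin.sum_univ_succ, Fin.cons_zero, hext0, hv0]
    have e1 : ∑ i : Fin m, (d ((Fin.cons l₀ μ : Fin (m + 1) → Fin K) i.succ) : ℤ) = ∑ i, (d (μ i) : ℤ) :=
      sum_congr rfl fun i _ => by rw [Fin.cons_succ]
    have e2 : ∑ i : Fin m, vb (Equiv.Perm.decomposeFin.symm (0, σ) i.succ) i.succ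
        ((Fin.cons l₀ μ : Fin (m + 1) → Fin K) i.succ) = ∑ i, v (σ i) i (μ i) :=
      sum_congr rfl fun i _ => by rw [hextsucc, Fin.cons_succ, hvsucc]
    rw [e1, e2]
    ring
  -- every present term of the bordered design is a lift
  have hpresent : ∀ q : Equiv.Perm (Fin (m + 1)) × (Fin (m + 1) → Fin K), termSign εb q ≠ 0 →
      ∃ (σ : Equiv.Perm (Fin m)) (μ : Fin m → Fin K),
        q = (Equiv.Perm.decomposeFin.symm (0, σ), (Fin.cons l₀ μ : Fin (m + 1) → Fin K)) := by
    intro q hq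
    have hfac : ∀ i, εb (q.1 i) i (q.2 i) ≠ 0 := present_of_termSign_ne_zero εb q hq
    have hq0 : q.1 0 = 0 := by
      by_contra hne
      apply hfac 0
      rw [hεb, dif_neg hne, dif_pos rfl]
    have hμ0 : q.2 0 = l₀ := by
      have h0 := hfac 0
      rw [hq0, hεb, dif_pos rfl, if_pos rfl] at h0
      by_contra hne
      exact h0 (if_neg hne)
    obtain ⟨P, hP⟩ : ∃ P : Fin (m + 1) × Equiv.Perm (Fin m), q.1 = Equiv.Perm.decomposeFin.symm P :=
      ⟨Equiv.Perm.decomposeFin q.1, (Equiv.symm_apply_apply _ _).symm⟩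
    obtain ⟨x, σ⟩ := P
    have hx : x = 0 := by
      have h0 := hq0
      rw [hP, Equiv.Perm.decomposeFin_symm_apply_zero] at h0
      exact h0
    subst hx
    refine ⟨σ, Fin.tail q.2, Prod.ext hP ?_⟩
    show q.2 = Fin.cons l₀ (Fin.tail q.2)
    rw [← hμ0]
    exact (Fin.cons_self_tail q.2).symm
  -- the lifted chain
  obtain ⟨pb, hpb⟩ : ∃ pb : Fin (n + 1) → Equiv.Perm (Fin (m + 1)) × (Fin (m + 1) → Fin K),
      ∀ k, pb k = (Equiv.Perm.decomposeFin.symm (0, (p k).1), (Fin.cons l₀ (p k).2 : Fin (m + 1) → Fin K)) :=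
    ⟨_, fun _ => rfl⟩
  have hsign' : ∀ k, termSign εb (pb k) = termSign ε (p k) := fun k => by rw [hpb, hsignL]
  refine h d vb εb n θ pb hεb1 hstb hθ (fun k => ⟨?_, fun q hq hqs => ?_⟩)
    (fun k => by rw [hsign', hsign']; exact halt k)
  · rw [hsign']; exact (hdom k).1
  · obtain ⟨σ, μ, rfl⟩ := hpresent q hqs
    have hne : (σ, μ) ≠ p k := by
      intro hh
      apply hq
      rw [hpb, ← hh]
    have hqs' : termSign ε (σ, μ) ≠ 0 := by rwa [hsignL] at hqs
    have hlt := (hdom k).2 (σ, μ) hne hqs'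
    rw [hpb, hweightL, hweightL]
    linarith

/-- **Monotonicity of the static row in the size.**  `m ≤ m' → TropRootLawAtStatic m' K B → TropRootLawAtStatic m K B`.
[folklore] -/
theorem tropRootLawAtStatic_of_le_size {m m' K B : ℕ} (hm : m ≤ m') (h : TropRootLawAtStatic m' K B) :
    TropRootLawAtStatic m K B := by
  obtain ⟨t, rfl⟩ := Nat.exists_eq_add_of_le hm
  clear hm
  induction t with
  | zero => exact h
  | succ t ih => exact ih (tropRootLawAtStatic_of_succ h)

/-- **The port embedding at every size.**  `m·K ≤ M → TropRootLawAtStatic M K B → TropRootLawAt m K B`: the static capacity at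
size `M` dominates the general capacity at size `⌊M/K⌋` (`tropRootLawAt_of_static_ports` + size padding). [folklore] -/
theorem tropRootLawAt_of_static_ports_le {m K M B : ℕ} (hM : m * K ≤ M) (h : TropRootLawAtStatic M K B) :
    TropRootLawAt m K B :=
  tropRootLawAt_of_static_ports m K B (tropRootLawAtStatic_of_le_size hM h)

end Summit.ValiantsHypothesis.ValiantsHypothesis.Theorems.LacunarySymmetroidMatrixDescartes.TropicalCensus
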